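import Mathlib
import HarnessLib
import Literature.Analysis.FluidPDE.SelfSimilar
import Literature.Analysis.FluidPDE.LocalTypeI
import Literature.Analysis.FluidPDE.VectorCalculus
import Literature.Analysis.UnboundedOperators.HeatKernel
import Summits.NavierStokesRegularity.NavierStokesRegularity.Theorems.PoloidalWindowDoorPoloidalWindowRigidityWindow
import Summits.NavierStokesRegularity.NavierStokesRegularity.Theorems.PoloidalWindowDoorPoloidalWindowRigidityRotate
import Summits.NavierStokesRegularity.NavierStokesRegularity.Theorems.PoloidalWindowDoorPoloidalWindowRigidityFirstIntegral
import Summits.NavierStokesRegularity.NavierStokesRegularity.Theorems.PoloidalWindowDoorPoloidalWindowRigidityFlat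

/-!
# Route `PoloidalWindowDoor` (staged, nsreg-p1), crux `PoloidalWindowRigidity` (K2) — the five-stub birth
# skeleton CLOSED MODULO ITS ONE OPEN STUB `stub_nonflatLiouville`

Cell ns-regularity-ideate, seat p6 (route-directed support; land `--supports <PoloidalWindowRigidity item>` once
the route is born). The birth skeleton `route-poloidal/bc/PoloidalWindowRigidity_birth.lean` (nsreg-p1 ROUND-8,
first-integral dichotomy) decomposes K2 into five stubs; four of them are now tree-level theorems of this seat:

* `…PoloidalWindowDoorPoloidalWindowRigidityWindow.stub_windowToEverywhere` (slice analyticity + identity theorem),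
* `…PoloidalWindowDoorPoloidalWindowRigidityRotate.stub_rotate` (WLOG `e = e₃`: pseudovector law of the curl +
  `O(3)`-covariance of the Oseen class),
* `…PoloidalWindowDoorPoloidalWindowRigidityFirstIntegral.stub_firstIntegral` (frozen constraint: `v·e` is a first
  integral of the vortex lines on the poloidal stratum),
* `…PoloidalWindowDoorPoloidalWindowRigidityFlat.stub_flatStratum` (branch (A): flat first integral ⇒ not
  backward-singular),

and the fifth, `stub_nonflatLiouville` (branch (B): a poloidal Type-I profile whose first integral `v·e₃` is NOT
flat along `e₀` on some slice is not backward-singular) is the genuinely OPEN residue (nsreg-p1 ROUND-8/9 branch (G)).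
This file proves the REDUCTION `poloidalWindowRigidity_of_nonflatLiouville`: the text of K2 (VERBATIM the staged
Theses decl `…Theses.PoloidalWindowDoor.PoloidalWindowRigidity`) follows from the statement of `stub_nonflatLiouville`
alone — the composition `PoloidalWindowRigidity_of` of the birth skeleton with the four proved stubs plugged in.
When the route is born, `theorem poloidalWindowRigidity_proof : …Theses.PoloidalWindowDoor.PoloidalWindowRigidity`
is ONE line from any proof `h` of the open stub: `poloidalWindowRigidity_of_nonflatLiouville h` (after `unfold`).

WHAT THIS IS NOT: not a claim about Navier–Stokes regularity, and not a proof of K2 — a kernel-checked reduction of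
K2 to its declared open residue, for a STAGED door route (bears_on LADDER-NS N0, rung N0-LocalTubeDoorPoloidal).
-/

noncomputable section

-- the summit and its single sub-problem share the name (CONVENTIONS §1), as in every Theorems file
set_option linter.dupNamespace false

namespace Summit.NavierStokesRegularity.NavierStokesRegularity.Theorems.PoloidalWindowDoorPoloidalWindowRigidity

open MeasureTheory Set Function Filter Topology TopologicalSpace Metric
open scoped RealInnerProductSpace InnerProductSpace
open Literature.Analysis Literature.Analysis.FluidPDE
open Summit.NavierStokesRegularity.NavierStokesRegularity.Theorems.PoloidalWindowDoorPoloidalWindowRigidityWindow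
open Summit.NavierStokesRegularity.NavierStokesRegularity.Theorems.PoloidalWindowDoorPoloidalWindowRigidityRotate
open Summit.NavierStokesRegularity.NavierStokesRegularity.Theorems.PoloidalWindowDoorPoloidalWindowRigidityFirstIntegral
open Summit.NavierStokesRegularity.NavierStokesRegularity.Theorems.PoloidalWindowDoorPoloidalWindowRigidityFlat

/-- **K2 `PoloidalWindowRigidity` reduced to its open residue `stub_nonflatLiouville`.** The hypothesis is
VERBATIM the registered signature of the birth-skeleton stub `stub_nonflatLiouville` (branch (B), non-flat first
integral); the conclusion is VERBATIM the text of the staged Theses decl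
`Summit.NavierStokesRegularity.NavierStokesRegularity.Theses.PoloidalWindowDoor.PoloidalWindowRigidity`: for a
Type-I-rate, continuous, unit-viscosity Oseen-mild, divergence-free profile on `(−∞,0) × ℝ³`, (a) every vorticity
slice is continuous and (b) for every `e ≠ 0`, if every slice carries a nonempty open set on which `⟪curl v(s), e⟫ = 0`
then the apex `(0,0)` is not backward-singular. Proof = the birth skeleton's composition `PoloidalWindowRigidity_of`
with the four proved stubs: window ⇒ everywhere (`stub_windowToEverywhere`), WLOG `e = e₃` (`stub_rotate`), the frozen
constraint (`stub_firstIntegral`), and the flat / non-flat dichotomy (`stub_flatStratum` / the hypothesis). -/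
theorem poloidalWindowRigidity_of_nonflatLiouville
    (h₅ : ∀ (C : ℝ) (v : ℝ → EuclideanSpace ℝ (Fin 3) → EuclideanSpace ℝ (Fin 3)),
      Literature.Analysis.FluidPDE.HasTypeITimeDecay C v →
      ContinuousOn (Function.uncurry v) (Set.Iio (0 : ℝ) ×ˢ Set.univ) →
      (∀ s t : ℝ, s < t → t < 0 → ∀ x, v t x =
        Literature.Analysis.UnboundedOperators.heatExtension (v s) (t - s) x -
          Literature.Analysis.FluidPDE.oseenDuhamel 1 s v v t x) →
      (∀ t < 0, Literature.Analysis.FluidPDE.VectorCalculus.IsDivFree (v t)) →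
      (∀ s < 0, ∀ y, ⟪Literature.Analysis.FluidPDE.curl (v s) y, EuclideanSpace.single 2 1⟫_ℝ = 0) →
      (∀ s < 0, ∀ y, ⟪fderiv ℝ (v s) y (Literature.Analysis.FluidPDE.curl (v s) y), EuclideanSpace.single 2 1⟫_ℝ = 0) →
      (∃ s < 0, ∃ y, fderiv ℝ (v s) y (EuclideanSpace.single 0 1) 2 ≠ 0) →
      ¬ Literature.Analysis.FluidPDE.IsBackwardSingularPoint v 0) :
    ∀ (C : ℝ) (v : ℝ → EuclideanSpace ℝ (Fin 3) → EuclideanSpace ℝ (Fin 3)), Literature.Analysis.FluidPDE.HasTypeITimeDecay C v → ContinuousOn (Function.uncurry v) (Set.Iio (0 : ℝ) ×ˢ Set.univ) → (∀ s t : ℝ, s < t → t < 0 → ∀ x, v t x = Literature.Analysis.UnboundedOperators.heatExtension (v s) (t - s) x - Literature.Analysis.FluidPDE.oseenDuhamel 1 s v v t x) → (∀ t < 0, Literature.Analysis.FluidPDE.VectorCalculus.IsDivFree (v t)) → (∀ s < 0, Continuous (Literature.Analysis.FluidPDE.curl (v s))) ∧ ∀ (e : EuclideanSpace ℝ (Fin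 3)), e ≠ 0 → (∀ s < 0, ∃ U : Set (EuclideanSpace ℝ (Fin 3)), IsOpen U ∧ U.Nonempty ∧ ∀ y ∈ U, ⟪Literature.Analysis.FluidPDE.curl (v s) y, e⟫_ℝ = 0) → ¬ Literature.Analysis.FluidPDE.IsBackwardSingularPoint v 0 := by
  intro C v hrate hcont hmild hdiv
  refine ⟨(stub_windowToEverywhere C v hrate hcont hmild hdiv).1, fun e he hwin hsing => ?_⟩
  have hall : ∀ s < 0, ∀ y, ⟪Literature.Analysis.FluidPDE.curl (v s) y, e⟫_ℝ = 0 :=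
    (stub_windowToEverywhere C v hrate hcont hmild hdiv).2 e he hwin
  obtain ⟨C', v', hrate', hcont', hmild', hdiv', hpol', hsing'⟩ :=
    stub_rotate C v hrate hcont hmild hdiv e he hall hsing
  have hfi := stub_firstIntegral C' v' hrate' hcont' hmild' hdiv' (EuclideanSpace.single 2 1) hpol'
  by_cases hflat : ∀ s < 0, ∀ y, fderiv ℝ (v' s) y (EuclideanSpace.single 0 1) 2 = 0
  · exact stub_flatStratum C' v' hrate' hcont' hmild' hdiv' hpol' hflat hsing'
  · push Not at hflat
    obtain ⟨s, hs, y, hy⟩ := hflat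
    exact h₅ C' v' hrate' hcont' hmild' hdiv' hpol' hfi ⟨s, hs, y, hy⟩ hsing'

end Summit.NavierStokesRegularity.NavierStokesRegularity.Theorems.PoloidalWindowDoorPoloidalWindowRigidity

end
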